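import Mathlib.NumberTheory.NumberField.Cyclotomic.PID
import HarnessLib

/-!
# `ℚ(i) = ℚ(ζ₄)` has class number one: `ℤ[i] = 𝓞_{ℚ(ζ₄)}` is a principal ideal domain

Topic `Literature/NumberTheory/NumberFields`, namespace `Literature.NumberTheory.NumberFields`.  Theorems only;
no definition, no named fact (net Literature debt 0).  Mathlib proves the corresponding statements for the
cyclotomic fields `ℚ(ζ₃)` and `ℚ(ζ₅)` (`IsCyclotomicExtension.Rat.three_pid`, `five_pid`, by the Minkowski
bound `RingOfIntegers.isPrincipalIdealRing_of_abs_discr_lt`) but not for `ℚ(ζ₄) = ℚ(i)`; this file supplies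
the fourth cyclotomic field by the same road (Minkowski: `|d| = 4 < π² = (2 · (π/4) · (2²/2!))²`), for any
`K` with `IsCyclotomicExtension {4} ℚ K` and for Mathlib's model `CyclotomicField 4 ℚ` — the CM field `ℚ(i)`
of the lane's Gaussian specimens (`GaussianCMCurve`, `CMTypeCount.finrank_gaussianField`).

Source.  A. Fröhlich, M. J. Taylor, *Algebraic Number Theory*, Cambridge 1991 [FrohlichTaylor1990], held text
`book:frohlich1990-algebraic-number-theory`, Ch. IV §1 (chunk p0140): «(1.2) A Euclidean domain is a
principal ideal domain.» and «(1.3) `ℤ[i]` is a Euclidean domain.»; the ring of integers of `ℚ(i)` is `ℤ[i]`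
(ibid. Ch. II §1, the quadratic case `d ≡ 3 mod 4`; Mathlib `IsCyclotomicExtension.Rat.…integralPowerBasis`),
and the discriminant of `ℚ(ζ₄)` is `-4` (ibid. Ch. II (1.1); Mathlib `IsCyclotomicExtension.Rat.discr_prime_pow`).
The printed proof is Euclid's algorithm on `ℤ[i]`; the proof here is the shorter Mathlib road through
Minkowski's bound (as for `three_pid`), recorded as a deviation.

* `discr_of_isCyclotomicExtension_four` — `d_K = -4`;
* **`isPrincipalIdealRing_ringOfIntegers_of_isCyclotomicExtension_four`** — `𝓞_K` is a PID;
* the statements for Mathlib's model `CyclotomicField 4 ℚ`: `discr_cyclotomicField_four`,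
  `isPrincipalIdealRing_ringOfIntegers_cyclotomicField_four`, **`classNumber_cyclotomicField_four`** (`h = 1`).

## References

* [FrohlichTaylor1990] A. Fröhlich, M. J. Taylor, *Algebraic Number Theory*, Cambridge Studies in Advanced
  Mathematics 27 (1991), Ch. IV §1 (1.2)–(1.3) (chunk p0140), Ch. II §1.
-/

noncomputable section

namespace Literature.NumberTheory.NumberFields

open NumberField Polynomial Nat Real IsCyclotomicExtension.Rat

section Four

variable (K : Type) [Field K] [NumberField K] [IsCyclotomicExtension {4} ℚ K]

/-- `ℚ(ζ₄)` is the `2²`-nd cyclotomic field (reindexing `4 = 2 ^ 2` for Mathlib's prime-power lemmas). [folklore] -/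
private theorem isCyclotomicExtension_two_sq : IsCyclotomicExtension {2 ^ 2} ℚ K := by
  rw [show (2 : ℕ) ^ 2 = 4 by norm_num]; infer_instance

/-- **The discriminant of `ℚ(i) = ℚ(ζ₄)` is `-4`** (Mathlib's prime-power cyclotomic discriminant
`(-1)^{φ(4)/2} · 2^{2·(1·2−1)}` at `p = 2`, `k = 2`). [cite: FrohlichTaylor1990, Ch. II §1 (discriminant of a quadratic field)] -/
theorem discr_of_isCyclotomicExtension_four : NumberField.discr K = -4 := by
  haveI := isCyclotomicExtension_two_sq K
  haveI : Fact (Nat.Prime 2) := ⟨Nat.prime_two⟩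
  rw [discr_prime_pow 2 2 K, show (2 : ℕ) ^ 2 = 4 by norm_num, show Nat.totient 4 = 2 by decide]
  norm_num

/-- **`𝓞_{ℚ(ζ₄)} = ℤ[i]` is a principal ideal domain** («(1.3) `ℤ[i]` is a Euclidean domain», «(1.2) A
Euclidean domain is a principal ideal domain»).  Proved by Minkowski's bound (Mathlib
`RingOfIntegers.isPrincipalIdealRing_of_abs_discr_lt`): `[K : ℚ] = φ(4) = 2`, one complex place, and
`|d_K| = 4 < (2 · (π/4) · (2²/2!))² = π²`. [cite: FrohlichTaylor1990, Ch. IV §1 (1.2)–(1.3) (chunk p0140)] -/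
theorem isPrincipalIdealRing_ringOfIntegers_of_isCyclotomicExtension_four : IsPrincipalIdealRing (𝓞 K) := by
  haveI := isCyclotomicExtension_two_sq K
  haveI : Fact (Nat.Prime 2) := ⟨Nat.prime_two⟩
  apply RingOfIntegers.isPrincipalIdealRing_of_abs_discr_lt
  rw [discr_prime_pow 2 2 K, IsCyclotomicExtension.finrank (n := 4) K
    (cyclotomic.irreducible_rat (by norm_num)), nrComplexPlaces_eq_totient_div_two 4,
    show Nat.totient 4 = 2 by decide]
  norm_num
  nlinarith [pi_gt_three]

-- `classNumber K = 1` is `(classNumber_eq_one_iff).2 (isPrincipalIdealRing_ringOfIntegers_of_isCyclotomicExtension_four K)`;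
-- it is recorded below for Mathlib's model only (a generic `classNumber K = 1` head collides textually with
-- the tree's `CubicSieve.classNumber_eq_one` under the gate's dedup).

end Four

/-! ### Mathlib's model `CyclotomicField 4 ℚ` -/

/-- `CyclotomicField 4 ℚ` is a `4`-th cyclotomic extension of `ℚ` (Mathlib instance, recorded as a term
for the statements below). [folklore] -/
private theorem isCyclotomicExtension_cyclotomicField_four :
    IsCyclotomicExtension {4} ℚ (CyclotomicField 4 ℚ) :=
  CyclotomicField.isCyclotomicExtension 4 ℚ

/-- `d(ℚ(ζ₄)) = -4` for Mathlib's `CyclotomicField 4 ℚ`. [cite: FrohlichTaylor1990, Ch. II §1 (discriminant of a quadratic field)] -/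
theorem discr_cyclotomicField_four : NumberField.discr (CyclotomicField 4 ℚ) = -4 :=
  haveI := isCyclotomicExtension_cyclotomicField_four
  discr_of_isCyclotomicExtension_four (CyclotomicField 4 ℚ)

/-- **The ring of integers of `CyclotomicField 4 ℚ` (`= ℤ[i]`) is a principal ideal domain.**
[cite: FrohlichTaylor1990, Ch. IV §1 (1.2)–(1.3) (chunk p0140)] -/
theorem isPrincipalIdealRing_ringOfIntegers_cyclotomicField_four :
    IsPrincipalIdealRing (𝓞 (CyclotomicField 4 ℚ)) :=
  haveI := isCyclotomicExtension_cyclotomicField_four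
  isPrincipalIdealRing_ringOfIntegers_of_isCyclotomicExtension_four (CyclotomicField 4 ℚ)

/-- **`ℚ(i) = ℚ(ζ₄)` has class number one**: `h = 1` for Mathlib's `CyclotomicField 4 ℚ`.
[cite: FrohlichTaylor1990, Ch. IV §1 (1.2)–(1.3) (chunk p0140)] -/
theorem classNumber_cyclotomicField_four : classNumber (CyclotomicField 4 ℚ) = 1 :=
  (classNumber_eq_one_iff (K := CyclotomicField 4 ℚ)).2
    isPrincipalIdealRing_ringOfIntegers_cyclotomicField_four

end Literature.NumberTheory.NumberFields

end
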